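import Summits.QuantumFields.YangMills.Theorems.LangevinControlUVOSLegsFromFemtoAndGapStubAssemblyDensityExpansion
import Summits.QuantumFields.YangMills.Theorems.LangevinControlUVOSLegsFromFemtoAndGapStubAssemblyRPObservable
import Summits.QuantumFields.YangMills.Theorems.PencilRigidityHypercubicLimitRpBlockMomentPerm
import HarnessLib

/-!
# Soft OS-assembly toolkit XXIII: exact invariance under permutations of the coordinate axes

Helper file for stub `stub_assembly6` of crux `OSLegsFromFemtoAndGap` (stmt-QuantumFields-9367, line
`dlr-collar-transfer`, reshape r2).  The centred density distributions are EXACTLY invariant under the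
coordinate permutations `P_π : (P_π v)ᵢ = v_{π⁻¹ i}` of `ℝ⁴` (`latticeDist_linActMulti_coordPerm`): the torus Wilson
state is invariant under `configPerm π` (tree `wilsonMeasure_map_configPerm`, packaged as `rpBlock_momentPerm`),
a permuted plaquette is a plaquette of the permuted (re-sorted) orientation at the permuted corner, the set of
the six planes is permuted, and the box is permutation invariant.  Hence the soft limit is invariant
(`softLimit_linActMulti_coordPerm`).  Also: `⁰𝒮` is stable under `linActMulti` (`IsOffDiagonal.linActMulti`).
-/

noncomputable section

open scoped SchwartzMap BigOperators
open MeasureTheory Filter Topology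
open Literature.MathematicalPhysics.QuantumFieldTheory Literature.MathematicalPhysics.QuantumLattice
open Literature.MathematicalPhysics.AQFT
open Literature.Probability.LatticeModels (box Site mem_box)
open Summit.QuantumFields.YangMills.Cruxes.OSLegsFromFemtoAndGap.DlrCollarTransfer (plane torusE)
open Summit.QuantumFields.YangMills.Theorems.HypercubicLimit.Negative (torusPlaquette)
open Summit.QuantumFields.YangMills.Cruxes.HypercubicLimit.ConditionalMeanTelescoping (rpBlock_momentPerm)

namespace Summit.QuantumFields.YangMills.Theorems.OSLegsFromFemtoAndGap

local notation "E4" => EuclideanSpace ℝ (Fin 4)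

/-! ### `⁰𝒮` is stable under linear isometries -/

/-- **`⁰𝒮` is stable under the diagonal action of a linear isometry.** -/
theorem _root_.Literature.MathematicalPhysics.AQFT.IsOffDiagonal.linActMulti {n : ℕ} {F : 𝓢((Fin n → E4), ℂ)}
    (hF : IsOffDiagonal F) (R : E4 ≃ₗᵢ[ℝ] E4) :
    IsOffDiagonal (Literature.MathematicalPhysics.QuantumLattice.linActMulti R F) := by
  intro x hx j
  set A : (Fin n → E4) ≃L[ℝ] (Fin n → E4) :=
    ContinuousLinearEquiv.piCongrRight fun _ : Fin n => R.symm.toContinuousLinearEquiv with hA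
  have hfun : ((Literature.MathematicalPhysics.QuantumLattice.linActMulti R F : 𝓢((Fin n → E4), ℂ)) :
      (Fin n → E4) → ℂ) = (F : (Fin n → E4) → ℂ) ∘ A := by
    funext y; rfl
  have hxA : A x ∈ coincidenceLocus n E4 := by
    obtain ⟨i, k, hik, hxik⟩ := hx
    exact ⟨i, k, hik, by simp [hA, hxik]⟩
  rw [hfun, show ((F : (Fin n → E4) → ℂ) ∘ A) = (F : (Fin n → E4) → ℂ) ∘ (A : (Fin n → E4) →L[ℝ] (Fin n → E4)) from rfl,
    (A : (Fin n → E4) →L[ℝ] (Fin n → E4)).iteratedFDeriv_comp_right (F.smooth j) x (i := j) le_rfl]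
  rw [show (A : (Fin n → E4) →L[ℝ] (Fin n → E4)) x = A x from rfl, hF (A x) hxA j]
  ext v
  rfl

/-! ### Sorted orientations and the permuted plane -/

/-- The plane `(π i, π j)` re-sorted. -/
def permPlane (π : Equiv.Perm (Fin 4)) (p : Fin 4 × Fin 4) : Fin 4 × Fin 4 :=
  if π p.1 < π p.2 then (π p.1, π p.2) else (π p.2, π p.1)

/-- A valid plane stays valid. -/
theorem permPlane_valid (π : Equiv.Perm (Fin 4)) {p : Fin 4 × Fin 4} (hp : p.1 < p.2) :
    (permPlane π p).1 < (permPlane π p).2 := by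
  unfold permPlane
  split_ifs with h
  · exact h
  · exact lt_of_le_of_ne (not_lt.1 h) fun heq => (ne_of_lt hp) (π.injective heq).symm

/-- `permPlane π⁻¹` undoes `permPlane π` on valid planes. -/
theorem permPlane_symm_permPlane (π : Equiv.Perm (Fin 4)) {p : Fin 4 × Fin 4} (hp : p.1 < p.2) :
    permPlane π.symm (permPlane π p) = p := by
  unfold permPlane
  by_cases h : π p.1 < π p.2
  · rw [if_pos h]; simp [hp]
  · rw [if_neg h]; simp [not_lt_of_gt hp]

variable {G : Type} [Group G] [TopologicalSpace G] [IsTopologicalGroup G] [CompactSpace G]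
  [MeasurableSpace G] [BorelSpace G]

omit [MeasurableSpace G] [BorelSpace G] in
/-- The torus plaquette is symmetric in its two directions (`Re tr ρ(g⁻¹) = Re tr ρ(g)`). -/
theorem torusPlaquette_swap (r : LatticeRep G) (S : ℕ) (i j : Fin 4) (y : Site 4) (U : GaugeConfig 4 S G) :
    torusPlaquette r S j i y U = torusPlaquette r S i j y U := by
  unfold torusPlaquette plaquetteObs
  rw [CurvatureBoostCovariance.Negative.plaquetteHolonomyZd_torusLift',
    CurvatureBoostCovariance.Negative.plaquetteHolonomyZd_torusLift', plaquetteHolonomy_swap,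
    Literature.RepresentationTheory.CompactGroups.CompactGroup.re_trace_map_inv r.ρ r.continuous]

omit [MeasurableSpace G] [BorelSpace G] in
/-- The torus plaquette of the re-sorted permuted plane. -/
theorem torusPlaquette_permPlane (r : LatticeRep G) (S : ℕ) (π : Equiv.Perm (Fin 4)) (p : Fin 4 × Fin 4)
    (y : Site 4) (U : GaugeConfig 4 S G) :
    torusPlaquette r S (permPlane π p).1 (permPlane π p).2 y U = torusPlaquette r S (π p.1) (π p.2) y U := by
  unfold permPlane
  split_ifs
  · rfl
  · exact torusPlaquette_swap r S _ _ y U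

/-! ### The string weights under coordinate permutations -/

/-- The permuted multi-site: `(π·x)ₗ i = xₗ (π⁻¹ i)`. -/
def permSites (π : Equiv.Perm (Fin 4)) {n : ℕ} (x : Fin n → Site 4) : Fin n → Site 4 :=
  fun l i => x l (π.symm i)

/-- **String weights are invariant under coordinate permutations** (corner permuted, planes re-sorted). -/
theorem torusMomentStr_coordPerm (r : LatticeRep G) (β : ℝ) (L : ℕ) (π : Equiv.Perm (Fin 4)) {n : ℕ}
    (q : Fin n → Fin 4 × Fin 4) (x : Fin n → Site 4) :
    torusMomentStr r.ρ β L (fun i U => plaquetteObs r.ρ 0 (q i).1 (q i).2 U)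
        (fun i => wilsonTorusMean r.ρ β L (fun U => plaquetteObs r.ρ 0 (q i).1 (q i).2 U)) x =
      torusMomentStr r.ρ β L (fun i U => plaquetteObs r.ρ 0 (permPlane π (q i)).1 (permPlane π (q i)).2 U)
        (fun i => wilsonTorusMean r.ρ β L (fun U => plaquetteObs r.ρ 0 (q i).1 (q i).2 U)) (permSites π x) := by
  unfold torusMomentStr
  have h := rpBlock_momentPerm G r β L n π q
    (fun i => wilsonTorusMean r.ρ β L (fun U => plaquetteObs r.ρ 0 (q i).1 (q i).2 U)) x
  have hl : ∀ (i : Fin n) (U : GaugeConfig 4 (2 * L + 1) G),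
      plaquetteObs r.ρ 0 (q i).1 (q i).2 (configShift (-(x i)) (torusLift (2 * L + 1) U)) =
        torusPlaquette r (2 * L + 1) (q i).1 (q i).2 (x i) U := fun i U => plane_torusLift r _ (q i) (x i) U
  have hr : ∀ (i : Fin n) (U : GaugeConfig 4 (2 * L + 1) G),
      plaquetteObs r.ρ 0 (permPlane π (q i)).1 (permPlane π (q i)).2
          (configShift (-(permSites π x i)) (torusLift (2 * L + 1) U)) =
        torusPlaquette r (2 * L + 1) (π (q i).1) (π (q i).2) (fun j => x i (π.symm j)) U := fun i U => by
    rw [← torusPlaquette_permPlane]; exact plane_torusLift r _ (permPlane π (q i)) (permSites π x i) U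
  simp_rw [hl, hr]
  exact h

/-- The torus mean of a plane field is invariant under coordinate permutations. -/
theorem wilsonTorusMean_permPlane (r : LatticeRep G) (β : ℝ) (L : ℕ) (π : Equiv.Perm (Fin 4)) (p : Fin 4 × Fin 4) :
    wilsonTorusMean r.ρ β L (fun U => plaquetteObs r.ρ 0 (permPlane π p).1 (permPlane π p).2 U) =
      wilsonTorusMean r.ρ β L (fun U => plaquetteObs r.ρ 0 p.1 p.2 U) := by
  rw [← torusE_plane_eq_wilsonTorusMean r β L p 0, ← torusE_plane_eq_wilsonTorusMean r β L (permPlane π p) (permSites π (fun _ : Fin 1 => (0 : Site 4)) 0)]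
  unfold torusE
  have h := rpBlock_momentPerm G r β L 1 π (fun _ => p) (fun _ => 0) (fun _ => 0)
  simp only [Finset.univ_unique, Fin.default_eq_zero, Finset.prod_singleton, sub_zero] at h
  have hl : ∀ U : GaugeConfig 4 (2 * L + 1) G, plane G r p 0 (torusLift (2 * L + 1) U) = torusPlaquette r (2 * L + 1) p.1 p.2 0 U :=
    fun U => plane_torusLift r _ p 0 U
  have hr : ∀ U : GaugeConfig 4 (2 * L + 1) G,
      plane G r (permPlane π p) (permSites π (fun _ : Fin 1 => (0 : Site 4)) 0) (torusLift (2 * L + 1) U) =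
        torusPlaquette r (2 * L + 1) (π p.1) (π p.2) (fun j => (0 : Site 4) (π.symm j)) U := fun U => by
    rw [← torusPlaquette_permPlane]; exact plane_torusLift r _ _ _ U
  simp_rw [hl, hr]
  exact h.symm

/-- Reindexing the valid plane strings by `permPlane π`. -/
theorem sum_planeStrings_permPlane {M : Type*} [AddCommMonoid M] (π : Equiv.Perm (Fin 4)) {n : ℕ}
    (f : (Fin n → Fin 4 × Fin 4) → M) :
    ∑ q ∈ Fintype.piFinset (fun _ : Fin n => Finset.univ.filter fun p : Fin 4 × Fin 4 => p.1 < p.2),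
        f (fun i => permPlane π (q i)) =
      ∑ q ∈ Fintype.piFinset (fun _ : Fin n => Finset.univ.filter fun p : Fin 4 × Fin 4 => p.1 < p.2), f q := by
  refine Finset.sum_bij' (fun q _ => fun i => permPlane π (q i)) (fun q _ => fun i => permPlane π.symm (q i))
    (fun q hq => ?_) (fun q hq => ?_) (fun q hq => ?_) (fun q hq => ?_) (fun q _ => rfl)
  · rw [mem_planeStrings_iff] at hq ⊢; exact fun i => permPlane_valid π (hq i)
  · rw [mem_planeStrings_iff] at hq ⊢; exact fun i => permPlane_valid π.symm (hq i)
  · rw [mem_planeStrings_iff] at hq; funext i; exact permPlane_symm_permPlane π (hq i)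
  · rw [mem_planeStrings_iff] at hq; funext i
    simpa using permPlane_symm_permPlane π.symm (hq i)

/-- **The centred density weight is invariant under coordinate permutations of the sites.** -/
theorem torusMoment_dens_permSites (r : LatticeRep G) (β : ℝ) (L : ℕ) (π : Equiv.Perm (Fin 4)) {n : ℕ}
    (x : Fin n → Site 4) :
    torusMoment r.ρ β L r.curvature.F (wilsonTorusMean r.ρ β L r.curvature.F) (permSites π x) =
      torusMoment r.ρ β L r.curvature.F (wilsonTorusMean r.ρ β L r.curvature.F) x := by
  rw [torusMoment_dens_eq_sum_torusMomentStr, torusMoment_dens_eq_sum_torusMomentStr,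
    ← sum_planeStrings_permPlane π]
  refine Finset.sum_congr rfl fun q _ => ?_
  rw [torusMomentStr_coordPerm r β L π q x]
  simp_rw [wilsonTorusMean_permPlane]

/-! ### The lattice distributions and the coordinate permutation of `ℝ⁴` -/

/-- The coordinate permutation `(P_π v)ᵢ = v_{π⁻¹ i}` of `ℝ⁴` as a linear isometry. -/
def coordPerm (π : Equiv.Perm (Fin 4)) : E4 ≃ₗᵢ[ℝ] E4 :=
  LinearIsometryEquiv.piLpCongrLeft 2 ℝ ℝ π

/-- `P_π⁻¹` on lattice points permutes the coordinates of the site. -/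
theorem coordPerm_symm_smul_siteToE (π : Equiv.Perm (Fin 4)) (a : ℝ) (y : Site 4) :
    (coordPerm π).symm (a • siteToE y) = a • siteToE (fun i => y (π i)) := by
  ext i
  simp [coordPerm, LinearIsometryEquiv.piLpCongrLeft_symm, siteToE_apply, Equiv.piCongrLeft'_apply]

/-- Reindexing multi-sites of the box by a coordinate permutation. -/
theorem sum_piFinset_box_permSites {M : Type*} [AddCommMonoid M] (π : Equiv.Perm (Fin 4)) (L : ℕ) {n : ℕ}
    (f : (Fin n → Site 4) → M) :
    ∑ x ∈ Fintype.piFinset (fun _ : Fin n => box 4 L), f (permSites π x) =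
      ∑ x ∈ Fintype.piFinset (fun _ : Fin n => box 4 L), f x := by
  refine Finset.sum_bij' (fun x _ => permSites π x) (fun x _ => permSites π.symm x) (fun x hx => ?_) (fun x hx => ?_)
    (fun x _ => ?_) (fun x _ => ?_) (fun x _ => rfl)
  · simp only [Fintype.mem_piFinset, mem_box, permSites] at hx ⊢; exact fun l i => hx l _
  · simp only [Fintype.mem_piFinset, mem_box, permSites] at hx ⊢; exact fun l i => hx l _
  · funext l i; simp [permSites]
  · funext l i; simp [permSites]

/-- **Exact invariance of the centred density distributions under coordinate permutations.** -/
theorem latticeDist_linActMulti_coordPerm (r : LatticeRep G) (β : ℝ) (L : ℕ) (a : ℝ) (π : Equiv.Perm (Fin 4))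
    {n : ℕ} (F : 𝓢((Fin n → E4), ℂ)) :
    latticeDist r.ρ β L a r.curvature.F (wilsonTorusMean r.ρ β L r.curvature.F) n (linActMulti (coordPerm π) F) =
      latticeDist r.ρ β L a r.curvature.F (wilsonTorusMean r.ρ β L r.curvature.F) n F := by
  rw [latticeDist_apply, latticeDist_apply]
  simp_rw [linActMulti_apply, coordPerm_symm_smul_siteToE]
  rw [← sum_piFinset_box_permSites π L]
  refine Finset.sum_congr rfl fun x _ => ?_
  rw [torusMoment_dens_permSites]
  simp [permSites]

/-- **The soft limit is invariant under coordinate permutations** on `⁰𝒮`. -/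
theorem softLimit_linActMulti_coordPerm (r : LatticeRep G) {βk : ℕ → ℝ} {Lk : ℕ → ℕ} {ak : ℕ → ℝ}
    (S₁ : SchwingerFamily E4) (hS₁0 : ∀ F : 𝓢((Fin 0 → E4), ℂ), S₁ 0 F = F default)
    (hS₁1 : ∀ F : 𝓢((Fin 1 → E4), ℂ), S₁ 1 F = 0)
    (hconv : ∀ n : ℕ, 2 ≤ n → ∀ F : 𝓢((Fin n → E4), ℂ), IsOffDiagonal F →
      Tendsto (fun k => latticeDist r.ρ (βk k) (Lk k) (ak k) r.curvature.F
        (wilsonTorusMean r.ρ (βk k) (Lk k) r.curvature.F) n F) atTop (𝓝 (S₁ n F)))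
    (π : Equiv.Perm (Fin 4)) (n : ℕ) (F : 𝓢((Fin n → E4), ℂ)) (hF : IsOffDiagonal F) :
    S₁ n (linActMulti (coordPerm π) F) = S₁ n F := by
  rcases Nat.lt_or_ge n 2 with hn | hn
  · interval_cases n
    · rw [hS₁0, hS₁0, linActMulti_apply]
      congr 1
      exact Subsingleton.elim _ _
    · rw [hS₁1, hS₁1]
  · refine tendsto_nhds_unique (hconv n hn _ (hF.linActMulti _)) ?_
    simp_rw [latticeDist_linActMulti_coordPerm]
    exact hconv n hn F hF

end Summit.QuantumFields.YangMills.Theorems.OSLegsFromFemtoAndGap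

end
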